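import Summits.HubbardSuperconductivity.HubbardSuperconductivity.Theses.AposterioriCapRg

/-!
# Stub `stub_ladderMono` of line `loewner-riccati-channel-sandwich`
# (crux `CapRgSymmetricCertificatePinned`, item stmt-HubbardSuperconductivity-14045, route AposterioriCapRg)

Loewner monotonicity of the one-step ladder (Bethe–Salpeter) map `Φ_R(X) = X (1 + R X)⁻¹` on the
pole-free domain: if the slice pair bubble is `R = S²` with `S ≥ 0`, `X₁ ≤ X₂` are Hermitian and
`1 + S Xᵢ S` is positive definite (`i = 1, 2`), then `Φ_R(X₁) ≤ Φ_R(X₂)` in Loewner order.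

Proof (pure finite-dimensional matrix analysis, no limits, works for singular `S`):

* Woodbury: with `A = 1 + S X S` invertible, `(1 + S S X)⁻¹ = 1 - S A⁻¹ S X`, hence
  `Φ_R(X) = X - (S X)ᴴ A⁻¹ (S X)` is the Schur complement of the Hermitian block matrix
  `B(X) = [[A, S X], [(S X)ᴴ, X]]` (`ladder_eq_schur`).
* `B(X₂) - B(X₁) = [S 1]ᴴ (X₂ - X₁) [S 1] ≥ 0` (`fromBlocks_ladder_split`).
* Schur complements (Mathlib's `Matrix.PosDef.fromBlocks₁₁`): the block matrix
  `[[A₁, S X₁], [(S X₁)ᴴ, X₁ - Φ_R(X₁)]]` has Schur complement `0`, hence is `≥ 0`; adding the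
  previous display, `[[A₂, S X₂], [(S X₂)ᴴ, X₂ - Φ_R(X₁)]] ≥ 0`, whose Schur complement is
  `Φ_R(X₂) - Φ_R(X₁) ≥ 0`.

Only Mathlib is used (`Matrix.PosSemidef` / `Matrix.PosDef` over `ℂ` with the `ComplexOrder`
partial order, the nonsingular inverse `Matrix.inv`).
-/

namespace Summit.HubbardSuperconductivity.CapRgSymmetricCertificatePinned.Loewner

open Matrix
open scoped ComplexOrder

section LadderMono

variable {n : Type*} [Fintype n] [DecidableEq n]

/-- Woodbury step, in a form `noncomm_ring` can check: if `(1 + S X S) Ai = 1` then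
`(1 + S S X) (1 - S Ai S X) = 1`. -/
theorem one_add_mul_mul_woodbury (S X Ai : Matrix n n ℂ) (h : (1 + S * X * S) * Ai = 1) :
    (1 + S * S * X) * (1 - S * Ai * S * X) = 1 := by
  calc (1 + S * S * X) * (1 - S * Ai * S * X)
      = 1 + S * S * X - S * ((1 + S * X * S) * Ai) * S * X := by noncomm_ring
    _ = 1 := by rw [h]; noncomm_ring

/-- The ladder step as a Schur complement: for `S`, `X` Hermitian with `A = 1 + S X S` invertible,
`X (1 + S S X)⁻¹ = X - (S X)ᴴ A⁻¹ (S X)`. -/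
theorem ladder_eq_schur (S X : Matrix n n ℂ) (hS : Sᴴ = S) (hX : Xᴴ = X)
    (hA : IsUnit (1 + S * X * S).det) :
    X * (1 + S * S * X)⁻¹ = X - (S * X)ᴴ * (1 + S * X * S)⁻¹ * (S * X) := by
  have hmul : (1 + S * X * S) * (1 + S * X * S)⁻¹ = 1 := mul_nonsing_inv _ hA
  rw [conjTranspose_mul, hS, hX]
  generalize (1 + S * X * S)⁻¹ = Ai at hmul ⊢
  rw [inv_eq_right_inv (one_add_mul_mul_woodbury S X Ai hmul)]
  noncomm_ring

/-- The block matrices `[[1 + S X S, S X], [(S X)ᴴ, X - P]]` split along `X₁ ≤ X₂`: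
`B(X₂) = B(X₁) + [S 1]ᴴ (X₂ - X₁) [S 1]` (for `S`, `X₁`, `X₂` Hermitian). -/
theorem fromBlocks_ladder_split (S X₁ X₂ P : Matrix n n ℂ) (hS : Sᴴ = S) (h₁ : X₁ᴴ = X₁)
    (h₂ : X₂ᴴ = X₂) :
    fromBlocks (1 + S * X₂ * S) (S * X₂) (S * X₂)ᴴ (X₂ - P) =
      fromBlocks (1 + S * X₁ * S) (S * X₁) (S * X₁)ᴴ (X₁ - P) +
        (fromCols S (1 : Matrix n n ℂ))ᴴ * (X₂ - X₁) * fromCols S (1 : Matrix n n ℂ) := by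
  rw [conjTranspose_fromCols_eq_fromRows_conjTranspose, fromRows_mul, fromRows_mul_fromCols,
    fromBlocks_add, conjTranspose_mul, conjTranspose_mul, hS, h₁, h₂, conjTranspose_one]
  congr 1 <;> noncomm_ring

/-- **Stub `stub_ladderMono`** (Loewner monotonicity of the Bethe–Salpeter step on the pole-free
domain): if the slice bubble `R = S²` is positive semidefinite (`S ≥ 0` a square root), `X₁ ≤ X₂`
are Hermitian, and no pole is crossed (`1 + S Xᵢ S` positive definite), then
`X₁ (1 + R X₁)⁻¹ ≤ X₂ (1 + R X₂)⁻¹`.  Proof: both sides are Schur complements (`ladder_eq_schur`);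
the block matrix `[[1 + S X₁ S, S X₁], [(S X₁)ᴴ, X₁ - Φ(X₁)]]` has Schur complement `0`, adding
`[S 1]ᴴ (X₂ - X₁) [S 1] ≥ 0` gives `[[1 + S X₂ S, S X₂], [(S X₂)ᴴ, X₂ - Φ(X₁)]] ≥ 0`
(`fromBlocks_ladder_split`), whose Schur complement is `Φ(X₂) - Φ(X₁)`
(`Matrix.PosDef.fromBlocks₁₁`). -/
theorem stub_ladderMono : ∀ {n : Type*} [Fintype n] [DecidableEq n] (R S X₁ X₂ : Matrix n n ℂ),
    R.PosSemidef → S.PosSemidef → S * S = R → X₁.IsHermitian → X₂.IsHermitian → (X₂ - X₁).PosSemidef →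
    (1 + S * X₁ * S).PosDef → (1 + S * X₂ * S).PosDef →
    (X₂ * (1 + R * X₂)⁻¹ - X₁ * (1 + R * X₁)⁻¹).PosSemidef := by
  intro n _ _ R S X₁ X₂ _ hS hSR h₁ h₂ hle hA₁ hA₂
  subst hSR
  have hS' : Sᴴ = S := hS.1
  have hu₁ : IsUnit (1 + S * X₁ * S).det := (isUnit_iff_isUnit_det _).mp hA₁.isUnit
  have hu₂ : IsUnit (1 + S * X₂ * S).det := (isUnit_iff_isUnit_det _).mp hA₂.isUnit
  letI : Invertible (1 + S * X₁ * S) := invertibleOfIsUnitDet _ hu₁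
  letI : Invertible (1 + S * X₂ * S) := invertibleOfIsUnitDet _ hu₂
  rw [ladder_eq_schur S X₁ hS' h₁ hu₁, ladder_eq_schur S X₂ hS' h₂ hu₂]
  -- `Φ(X₁)` as a Schur complement
  set P := X₁ - (S * X₁)ᴴ * (1 + S * X₁ * S)⁻¹ * (S * X₁) with hP
  -- the block matrix over `X₁` with corner `X₁ - Φ(X₁)` has Schur complement `0`
  have h0 : (fromBlocks (1 + S * X₁ * S) (S * X₁) (S * X₁)ᴴ (X₁ - P)).PosSemidef := by
    rw [hA₁.fromBlocks₁₁, hP, sub_sub_cancel, sub_self]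
    exact PosSemidef.zero
  -- add `[S 1]ᴴ (X₂ - X₁) [S 1] ≥ 0`
  have hbig : (fromBlocks (1 + S * X₂ * S) (S * X₂) (S * X₂)ᴴ (X₂ - P)).PosSemidef := by
    rw [fromBlocks_ladder_split S X₁ X₂ P hS' h₁ h₂]
    exact h0.add (hle.conjTranspose_mul_mul_same _)
  -- read off the Schur complement over `X₂`
  have hfin := (hA₂.fromBlocks₁₁ _ _).mp hbig
  rwa [sub_right_comm] at hfin

end LadderMono

end Summit.HubbardSuperconductivity.CapRgSymmetricCertificatePinned.Loewner
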